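import Literature.Analysis.FluidPDE.ClassicalSupStabilitySmoothing
import Literature.Analysis.FluidPDE.OseenHeatKernelBridge
import HarnessLib

/-!
# Sup-norm stability and `L² → L^∞` smoothing of the gap between two bounded classical
# Navier–Stokes solutions on `ℝ³` — with an EXPLICIT slice constant

Analysis/FluidPDE proof file (theorems only; no definitions, no named facts, no `sorry`). The
tree's sup-norm stability statements for two bounded classical forced solutions on a slab
(`sup_stability_forced_core`, `ClassicalSupStabilityForced.lean`: Gronwall fee
`exp (36 C₀² (M+M')² t/ν)`; `sup_stability_forced_smoothing_core`,
`ClassicalSupStabilitySmoothing.lean`: shortness `(24 C₀ (M+M'))² T ≤ ν`) are written with the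
slice constant `C₀ = oseenSliceConst ℝ³` of the Oseen–Koch–Tataru kernel
(`‖N_σ[a,b](x)‖ ≤ C₀ σ^{-1/2} ‖a‖_∞ ‖b‖_∞`, KNSS 2009 §3 (3.5)). That constant is
`Classical.choose` of an existence statement, so NO upper bound for it is provable: as stated,
none of those theorems can be evaluated by a numerical (certificate) argument. This file supplies
the evaluable versions:

* `norm_oseenSlice_le_explicit_three`: in dimension three, for MEASURABLE bounded fields,
  `‖N_σ[a,b](x)‖ ≤ 8829 σ^{-1/2} M_a M_b` — from the other realisation of `e^{σΔ}P∇·` in the tree,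
  the heat-flow operator `oseenHeat` with its explicit bound `norm_oseenHeat_le_of_top`
  (`2943 σ^{-1/2} M_a M_b` per component; `8829 = 3 · 2943`) and the bridge
  `sum_oseenHeat_smul_eq_oseenSlice` (`OseenHeatKernelBridge.lean`). The numeral is crude (it
  descends from the unoptimised `327` of `OseenHeat.lean`), but it is a NUMBER;
* `norm_oseenDuhamel_le_setIntegral_visc_of_sliceBound`: the bilinear Duhamel term against
  time-dependent slice bounds, for ANY constant `C` with the slice property on measurable bounded
  fields (hypothesis inline, no definition);
* `sup_stability_forced_core_of_sliceBound`, `sup_stability_forced_smoothing_core_of_sliceBound`: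
  the two cores, PARAMETRIC in such a `C` (proofs = those of the `C₀` versions, the slices of
  classical solutions being continuous hence measurable);
* the EXPLICIT instances (`C = 8829`): `sup_stability_forced_core_explicit`
  (fee `exp (36 · 8829² (M+M')² t/ν)`), `sup_stability_forced_free_explicit` (`u` unforced, `g'`
  measured in `L²`), `sup_stability_forced_smoothing_core_explicit` (shortness
  `(24 · 8829 (M+M'))² T ≤ ν`) and the terminal-window form
  `sup_stability_forced_smoothing_free_window_explicit` — the first sup-norm continuous-dependence
  statements of the tree whose hypotheses and constants are all numerals.

Consumer: the cell `ns-blowup` (route `PalasekTowerBreakdown`, crux `EpisodeBase`,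
stmt-NavierStokesRegularity-19179), certificate road (ii): `L²` gap over the long window at the
strain-rate fee (`l2_stability_strain_forced`) ⟶ smoothing on the short terminal windows ⟶ the
sup-norm readouts of `palasekTowerBreakdown_episodeBase_of_lineGerm_nearFreeRun`; the initial layer
`[1, 1+h]` (equal data) is `sup_stability_forced_free_explicit` with `D = 0`, whose fee on a window
with `(24 · 8829 (M+M'))² h ≤ ν` is `e^{36/576} = e^{1/16}`. LABEL: Literature port (a-priori
estimates for GIVEN solutions). WHAT THIS IS NOT: not a statement about Navier–Stokes regularity or
blow-up — continuous dependence over a FIXED slab for solutions assumed classical and bounded.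

## Mathlib / tree search

Tree: `sum_oseenHeat_smul_eq_oseenSlice`, `memLp_top_rankOne` (`OseenHeatKernelBridge`);
`norm_oseenHeat_le_of_top` (`OseenHeatSemigroup`); `norm_sum_smul_stdOrthonormalBasis_le`
(`OseenDuhamelMeasurable`); `oseenSliceConst`, `exists_norm_oseenSlice_le` (the unexplicit
constant: `OseenDuhamelPairCalculus`, `OseenSlice`); the `C₀` cores `sup_stability_forced_core`,
`sup_stability_forced_smoothing_core` and their tools (`setIntegral_visc_abelKernel_mul_exp_le`,
`forceDuhamel_sub_of_continuous`, `norm_forceDuhamel_le_of_eLpNorm_two`,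
`norm_heatExtension_le_of_eLpNorm_two`, `IsClassicalNSSolutionOn.ae_eq_forced_oseenMild`,
`oseenDuhamel_sub_left/right`). `lean search 'oseenSliceConst'`: positivity and LOWER bounds only
(`inv_sqrt_pi_le_oseenSliceConst`, `oseenSliceConst_gt`); no explicit slice bound for `oseenSlice`
was stated (the number `2943` lived inside the proof of the bridge).

## References

* J. Leray, *Sur le mouvement d'un liquide visqueux emplissant l'espace*, Acta Math. 63 (1934),
  §19 (3.4)–(3.8). [Leray1934]
* G. Koch, N. Nadirashvili, G. Seregin, V. Šverák, Acta Math. 203 (2009), §3 (3.3)–(3.5).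
  [KochNadirashviliSereginSverak2009]
* W. S. Ożański, B. C. Pooley, *Leray's fundamental work on the Navier–Stokes equations*, LMS
  Lecture Note Ser. 452 (2018), (6.65) and Lemma 6.5. [OzanskiPooley2018]
* P. G. Lemarié-Rieusset, *The Navier–Stokes Problem in the 21st Century*, CRC Press 2016, Thm. 6.1
  (6.12) with Prop. 6.5. [LemarieRieusset2016]
-/

noncomputable section

open MeasureTheory Set Function Filter
open _root_.Topology
open scoped ENNReal NNReal RealInnerProductSpace

namespace Literature.Analysis.FluidPDE

/-! ### The explicit slice bound in dimension three -/

section Slice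

/-- **Explicit sup bound of the Oseen–Koch–Tataru slice operator in dimension three**: for
measurable fields with `‖a‖ ≤ M_a`, `‖b‖ ≤ M_b` and `σ > 0`,
`‖N_σ[a, b](x)‖ ≤ 8829 σ^{-1/2} M_a M_b` at every `x`. Proof: `N_σ[a,b] = ∑ᵢ (𝒩_σ[a⊗b])ᵢ eᵢ`
(`sum_oseenHeat_smul_eq_oseenSlice`) and `|(𝒩_σ F)ᵢ| ≤ 2943 σ^{-1/2} M_a M_b`
(`norm_oseenHeat_le_of_top`), summed over the three components.
[cite: KochNadirashviliSereginSverak2009, §3 (3.3)–(3.5) (arXiv:0709.3599v1 pp. 6–7)] -/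
theorem norm_oseenSlice_le_explicit_three {σ : ℝ} (hσ : 0 < σ)
    {a b : EuclideanSpace ℝ (Fin 3) → EuclideanSpace ℝ (Fin 3)} {Ma Mb : ℝ}
    (ham : Measurable a) (hbm : Measurable b) (ha : ∀ y, ‖a y‖ ≤ Ma) (hb : ∀ y, ‖b y‖ ≤ Mb)
    (x : EuclideanSpace ℝ (Fin 3)) :
    ‖oseenSlice σ a b x‖ ≤ 8829 * σ ^ (-(1 / 2 : ℝ)) * Ma * Mb := by
  have hE : Module.finrank ℝ (EuclideanSpace ℝ (Fin 3)) = 3 := finrank_euclideanSpace_fin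
  set e := stdOrthonormalBasis ℝ (EuclideanSpace ℝ (Fin 3)) with he
  set F : Fin (Module.finrank ℝ (EuclideanSpace ℝ (Fin 3))) →
      Fin (Module.finrank ℝ (EuclideanSpace ℝ (Fin 3))) → EuclideanSpace ℝ (Fin 3) → ℝ :=
    fun j k y => ⟪a y, e j⟫ * ⟪b y, e k⟫ with hF
  have hFab : ∀ j k y, F j k y = ⟪a y, e j⟫ * ⟪b y, e k⟫ := fun _ _ _ => rfl
  have hMa : 0 ≤ Ma := (norm_nonneg _).trans (ha 0)
  have hMb : 0 ≤ Mb := (norm_nonneg _).trans (hb 0)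
  have hFm : ∀ j k, MemLp (F j k) ∞ volume := fun j k =>
    (memLp_top_rankOne ham hbm ha hb hFab j k).1
  have hFB : ∀ j k, eLpNorm (F j k) ∞ volume ≤ ENNReal.ofReal (Ma * Mb) := fun j k =>
    (memLp_top_rankOne ham hbm ha hb hFab j k).2
  rw [← sum_oseenHeat_smul_eq_oseenSlice hE ham hbm ha hb hFab hσ x]
  refine (norm_sum_smul_stdOrthonormalBasis_le _).trans ?_
  calc ∑ i, |oseenHeat σ F i x|
      ≤ ∑ _i : Fin (Module.finrank ℝ (EuclideanSpace ℝ (Fin 3))), 2943 * σ ^ (-(1 / 2 : ℝ)) * (Ma * Mb) :=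
        Finset.sum_le_sum fun i _ => by
          rw [← Real.norm_eq_abs]
          exact norm_oseenHeat_le_of_top hE hFm (mul_nonneg hMa hMb) hFB hσ i x
    _ = (Module.finrank ℝ (EuclideanSpace ℝ (Fin 3)) : ℝ) * (2943 * σ ^ (-(1 / 2 : ℝ)) * (Ma * Mb)) := by
        rw [Finset.sum_const, Finset.card_univ, Fintype.card_fin, nsmul_eq_mul]
    _ = 8829 * σ ^ (-(1 / 2 : ℝ)) * Ma * Mb := by rw [hE]; push_cast; ring

/-- **Sup bound of the bilinear term with time-dependent slice bounds, PARAMETRIC in the slice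
constant**: if `C` has the slice property on measurable bounded fields, `a τ, b τ` are measurable
with `‖a τ y‖ ≤ M_a(τ)`, `‖b τ y‖ ≤ M_b(τ)` for `τ ∈ (s, t)` and
`τ ↦ (ν(t-τ))^{-1/2} M_a(τ) M_b(τ)` is integrable on `(s, t)`, then
`‖B^ν_s(a,b)(t)(x)‖ ≤ C ∫_{(s,t)} (ν(t-τ))^{-1/2} M_a(τ) M_b(τ) dτ` (the tree's
`norm_oseenDuhamel_le_setIntegral_visc` is the case `C = C₀`, without measurability).
[cite: KochNadirashviliSereginSverak2009, §3 (3.5) and §4 p. 8 (arXiv:0709.3599v1)] -/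
theorem norm_oseenDuhamel_le_setIntegral_visc_of_sliceBound {C ν s t : ℝ}
    (hC : ∀ {σ : ℝ}, 0 < σ → ∀ {a b : EuclideanSpace ℝ (Fin 3) → EuclideanSpace ℝ (Fin 3)} {Ma Mb : ℝ},
      Measurable a → Measurable b → (∀ y, ‖a y‖ ≤ Ma) → (∀ y, ‖b y‖ ≤ Mb) → ∀ x,
        ‖oseenSlice σ a b x‖ ≤ C * σ ^ (-(1 / 2 : ℝ)) * Ma * Mb)
    (hν : 0 < ν) {a b : ℝ → EuclideanSpace ℝ (Fin 3) → EuclideanSpace ℝ (Fin 3)} {Ma Mb : ℝ → ℝ}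
    (ham : ∀ τ ∈ Ioo s t, Measurable (a τ)) (hbm : ∀ τ ∈ Ioo s t, Measurable (b τ))
    (ha : ∀ τ ∈ Ioo s t, ∀ y, ‖a τ y‖ ≤ Ma τ) (hb : ∀ τ ∈ Ioo s t, ∀ y, ‖b τ y‖ ≤ Mb τ)
    (hint : IntegrableOn (fun τ => (ν * (t - τ)) ^ (-(1 / 2 : ℝ)) * (Ma τ * Mb τ)) (Ioo s t))
    (x : EuclideanSpace ℝ (Fin 3)) :
    ‖oseenDuhamel ν s a b t x‖ ≤
      C * ∫ τ in Ioo s t, (ν * (t - τ)) ^ (-(1 / 2 : ℝ)) * (Ma τ * Mb τ) := by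
  rw [oseenDuhamel_apply, ← integral_const_mul]
  refine norm_integral_le_of_norm_le (hint.const_mul _) ?_
  filter_upwards [ae_restrict_mem measurableSet_Ioo] with τ hτ
  have hσ : 0 < ν * (t - τ) := mul_pos hν (sub_pos.2 hτ.2)
  calc ‖∫ y, oseenKernel (ν * (t - τ)) (x - y) (a τ y) (b τ y)‖
      = ‖oseenSlice (ν * (t - τ)) (a τ) (b τ) x‖ := by rw [oseenSlice_apply]
    _ ≤ C * (ν * (t - τ)) ^ (-(1 / 2 : ℝ)) * Ma τ * Mb τ :=
        hC hσ (ham τ hτ) (hbm τ hτ) (ha τ hτ) (hb τ hτ) x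
    _ = C * ((ν * (t - τ)) ^ (-(1 / 2 : ℝ)) * (Ma τ * Mb τ)) := by ring

end Slice

/-! ### Calculus (private copies of the Beta-integral helpers of `ClassicalSupStabilitySmoothing`) -/

section Calculus

/-- **A numerical bound for the Beta integral `∫₀¹ (1−s)^{-1/2} s^{-3/4} ds ≤ 12`** (its value is
`B(1/4, 1/2) = Γ(1/4)Γ(1/2)/Γ(3/4) ≈ 5.24`): split at `s = 1/2` (`one_sub_rpow_mul_rpow_le`:
`(1−s)^{-1/2} s^{-3/4} ≤ 2^{1/2} s^{-3/4} + 2^{3/4} (1−s)^{-1/2}`), bound `2^{1/2}, 2^{3/4} ≤ 2`, and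
integrate `∫₀¹ s^{-3/4} = 4`, `∫₀¹ (1−s)^{-1/2} = 2`. [folklore] -/
private theorem integral_one_sub_rpow_half_mul_rpow_threeQuarter_le :
    ∫ s in (0 : ℝ)..1, (1 - s) ^ (-(1 / 2 : ℝ)) * s ^ (-(3 / 4 : ℝ)) ≤ 12 := by
  have hI : IntervalIntegrable (fun s : ℝ => (1 - s) ^ (-(1 / 2 : ℝ)) * s ^ (-(3 / 4 : ℝ))) volume 0 1 :=
    intervalIntegrable_one_sub_rpow_mul_rpow (a := 1 / 2) (b := 3 / 4) (by norm_num) (by norm_num)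
      (by norm_num) (by norm_num)
  have h1 : IntervalIntegrable (fun s : ℝ => s ^ (-(3 / 4 : ℝ))) volume 0 1 :=
    intervalIntegral.intervalIntegrable_rpow' (by norm_num)
  have h2 : IntervalIntegrable (fun s : ℝ => (1 - s) ^ (-(1 / 2 : ℝ))) volume 0 1 := by
    have h := (intervalIntegral.intervalIntegrable_rpow' (a := 0) (b := 1) (r := -(1 / 2 : ℝ))
      (by norm_num)).comp_sub_left 1
    simp only [sub_zero, sub_self] at h
    exact h.symm
  have h2a : (2 : ℝ) ^ (1 / 2 : ℝ) ≤ 2 := by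
    conv_rhs => rw [← Real.rpow_one 2]
    exact Real.rpow_le_rpow_of_exponent_le (by norm_num) (by norm_num)
  have h2b : (2 : ℝ) ^ (3 / 4 : ℝ) ≤ 2 := by
    conv_rhs => rw [← Real.rpow_one 2]
    exact Real.rpow_le_rpow_of_exponent_le (by norm_num) (by norm_num)
  have hmono : ∫ s in (0 : ℝ)..1, (1 - s) ^ (-(1 / 2 : ℝ)) * s ^ (-(3 / 4 : ℝ)) ≤
      ∫ s in (0 : ℝ)..1, (2 * s ^ (-(3 / 4 : ℝ)) + 2 * (1 - s) ^ (-(1 / 2 : ℝ))) := by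
    refine intervalIntegral.integral_mono_on_of_le_Ioo zero_le_one hI
      ((h1.const_mul 2).add (h2.const_mul 2)) fun s hs => ?_
    have h := one_sub_rpow_mul_rpow_le (a := 1 / 2) (b := 3 / 4) (by norm_num) (by norm_num) hs
    have hs1 : 0 ≤ s ^ (-(3 / 4 : ℝ)) := Real.rpow_nonneg hs.1.le _
    have hs2 : 0 ≤ (1 - s) ^ (-(1 / 2 : ℝ)) := Real.rpow_nonneg (by linarith [hs.2]) _
    calc (1 - s) ^ (-(1 / 2 : ℝ)) * s ^ (-(3 / 4 : ℝ))
        ≤ 2 ^ (1 / 2 : ℝ) * s ^ (-(3 / 4 : ℝ)) + 2 ^ (3 / 4 : ℝ) * (1 - s) ^ (-(1 / 2 : ℝ)) := h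
      _ ≤ 2 * s ^ (-(3 / 4 : ℝ)) + 2 * (1 - s) ^ (-(1 / 2 : ℝ)) := by gcongr
  have i1 : ∫ s in (0 : ℝ)..1, s ^ (-(3 / 4 : ℝ)) = 4 := by
    rw [integral_rpow (Or.inl (by norm_num))]
    rw [show (-(3 / 4 : ℝ) + 1) = 1 / 4 by norm_num, Real.one_rpow, Real.zero_rpow (by norm_num)]
    norm_num
  have i2 : ∫ s in (0 : ℝ)..1, (1 - s) ^ (-(1 / 2 : ℝ)) = 2 := by
    rw [intervalIntegral.integral_comp_sub_left (fun x : ℝ => x ^ (-(1 / 2 : ℝ))) 1]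
    simp only [sub_self, sub_zero]
    rw [integral_rpow (Or.inl (by norm_num))]
    rw [show (-(1 / 2 : ℝ) + 1) = 1 / 2 by norm_num, Real.one_rpow, Real.zero_rpow (by norm_num)]
    norm_num
  have hsum : ∫ s in (0 : ℝ)..1, (2 * s ^ (-(3 / 4 : ℝ)) + 2 * (1 - s) ^ (-(1 / 2 : ℝ))) = 12 := by
    rw [intervalIntegral.integral_add (h1.const_mul 2) (h2.const_mul 2),
      intervalIntegral.integral_const_mul, intervalIntegral.integral_const_mul, i1, i2]
    norm_num
  exact hmono.trans hsum.le

/-- **The Abel integral against the weight `τ^{-3/4}` at viscosity `ν`**: for `ν > 0`, `t > 0` and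
a constant `K ≥ 0`, the integrand `(ν(t−τ))^{-1/2} · (K τ^{-3/4})` is integrable on `(0, t)` and
`∫_{(0,t)} (ν(t−τ))^{-1/2} (K τ^{-3/4}) dτ ≤ K ν^{-1/2} · 12 t^{-1/4}` (Beta scaling
`∫₀ᵗ (t−τ)^{-1/2} τ^{-3/4} dτ = t^{-1/4} ∫₀¹ (1−s)^{-1/2} s^{-3/4} ds`). [folklore] -/
private theorem setIntegral_visc_abelKernel_mul_rpow_threeQuarter_le {ν t K : ℝ} (hν : 0 < ν) (ht : 0 < t)
    (hK : 0 ≤ K) :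
    IntegrableOn (fun τ => (ν * (t - τ)) ^ (-(1 / 2 : ℝ)) * (K * τ ^ (-(3 / 4 : ℝ)))) (Ioo 0 t) ∧
    ∫ τ in Ioo 0 t, (ν * (t - τ)) ^ (-(1 / 2 : ℝ)) * (K * τ ^ (-(3 / 4 : ℝ))) ≤
      K * ν ^ (-(1 / 2 : ℝ)) * (12 * t ^ (-(1 / 4 : ℝ))) := by
  -- the integrand, rewritten on `(0, t)`
  have heqOn : EqOn (fun τ => (ν * (t - τ)) ^ (-(1 / 2 : ℝ)) * (K * τ ^ (-(3 / 4 : ℝ))))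
      (fun τ => (K * ν ^ (-(1 / 2 : ℝ))) * ((t - τ) ^ (-(1 / 2 : ℝ)) * τ ^ (-(3 / 4 : ℝ))))
      (Ioo 0 t) := by
    intro τ hτ
    simp only
    rw [Real.mul_rpow hν.le (sub_nonneg.2 hτ.2.le)]
    ring
  have hfI : IntegrableOn (fun τ : ℝ => (t - τ) ^ (-(1 / 2 : ℝ)) * τ ^ (-(3 / 4 : ℝ))) (Ioo 0 t) := by
    have h := intervalIntegrable_sub_rpow_mul_rpow (a := 1 / 2) (b := 3 / 4) (by norm_num)
      (by norm_num) (by norm_num) (by norm_num) ht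
    rwa [intervalIntegrable_iff_integrableOn_Ioo_of_le ht.le] at h
  have hI : IntegrableOn
      (fun τ => (K * ν ^ (-(1 / 2 : ℝ))) * ((t - τ) ^ (-(1 / 2 : ℝ)) * τ ^ (-(3 / 4 : ℝ))))
      (Ioo 0 t) := hfI.const_mul _
  refine ⟨hI.congr_fun heqOn.symm measurableSet_Ioo, ?_⟩
  rw [setIntegral_congr_fun measurableSet_Ioo heqOn, integral_const_mul,
    setIntegral_Ioo_sub_rpow_mul_rpow (a := 1 / 2) (b := 3 / 4) ht,
    show (1 : ℝ) - 1 / 2 - 3 / 4 = -(1 / 4 : ℝ) by norm_num]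
  have hKν : 0 ≤ K * ν ^ (-(1 / 2 : ℝ)) := mul_nonneg hK (Real.rpow_nonneg hν.le _)
  have ht4 : 0 ≤ t ^ (-(1 / 4 : ℝ)) := Real.rpow_nonneg ht.le _
  have hB := integral_one_sub_rpow_half_mul_rpow_threeQuarter_le
  calc K * ν ^ (-(1 / 2 : ℝ)) *
        (t ^ (-(1 / 4 : ℝ)) * ∫ s in (0 : ℝ)..1, (1 - s) ^ (-(1 / 2 : ℝ)) * s ^ (-(3 / 4 : ℝ)))
      ≤ K * ν ^ (-(1 / 2 : ℝ)) * (t ^ (-(1 / 4 : ℝ)) * 12) := by gcongr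
    _ = K * ν ^ (-(1 / 2 : ℝ)) * (12 * t ^ (-(1 / 4 : ℝ))) := by ring

end Calculus

/-! ### The two cores, parametric in the slice constant -/

section Core

variable {ν T M M' D E₀ F : ℝ}
  {g g' u u' : ℝ → EuclideanSpace ℝ (Fin 3) → EuclideanSpace ℝ (Fin 3)}
  {p p' : ℝ → EuclideanSpace ℝ (Fin 3) → ℝ} {G G' : ℝ} {G₂ G₂' : ℝ≥0∞}

/-- **Sup-norm stability of bounded classical finite-energy forced solutions, PARAMETRIC in the
slice constant** (the tree's `sup_stability_forced_core` with the unexplicit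
`C₀ = oseenSliceConst ℝ³` replaced by ANY constant `C > 0` satisfying the slice bound
`‖N_σ[a,b](x)‖ ≤ C σ^{-1/2} M_a M_b` on measurable bounded fields): two classical solutions on
`[0, T] × ℝ³` (`ν > 0`) with jointly continuous, bounded, weakly divergence-free, square-integrable
forces, finite energy, `‖u‖ ≤ M`, `‖u'‖ ≤ M'`, `‖u'(0) − u(0)‖ ≤ D`, force-Duhamel gap `≤ F`
⟹ `‖u'(t,x) − u(t,x)‖ ≤ 2 (D + F) exp (36 C² (M + M')² t / ν)` on the slab.
[cite: Leray1934, §19 (3.4)–(3.8)] [cite: LemarieRieusset2016, Thm. 6.1 (6.12) with Prop. 6.5]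
[cite: OzanskiPooley2018, Lemma 6.5] -/
theorem sup_stability_forced_core_of_sliceBound {C : ℝ} (hC0 : 0 < C)
    (hC : ∀ {σ : ℝ}, 0 < σ → ∀ {a b : EuclideanSpace ℝ (Fin 3) → EuclideanSpace ℝ (Fin 3)} {Ma Mb : ℝ},
      Measurable a → Measurable b → (∀ y, ‖a y‖ ≤ Ma) → (∀ y, ‖b y‖ ≤ Mb) → ∀ x,
        ‖oseenSlice σ a b x‖ ≤ C * σ ^ (-(1 / 2 : ℝ)) * Ma * Mb)
    (hν : 0 < ν) (hT : 0 < T)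
    (hcl : IsClassicalNSSolutionOn (Icc 0 T) ν g u p)
    (hcl' : IsClassicalNSSolutionOn (Icc 0 T) ν g' u' p')
    (hgc : Continuous (uncurry g)) (hg'c : Continuous (uncurry g'))
    (hG : ∀ τ ∈ Icc 0 T, ∀ y, ‖g τ y‖ ≤ G) (hG' : ∀ τ ∈ Icc 0 T, ∀ y, ‖g' τ y‖ ≤ G')
    (hgdiv : ∀ τ ∈ Icc 0 T, IsWeaklyDivFree (g τ)) (hg'div : ∀ τ ∈ Icc 0 T, IsWeaklyDivFree (g' τ))
    (hG₂ : G₂ ≠ ⊤) (hG₂' : G₂' ≠ ⊤)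
    (hg2 : ∀ τ ∈ Icc 0 T, eLpNorm (g τ) 2 volume ≤ G₂)
    (hg'2 : ∀ τ ∈ Icc 0 T, eLpNorm (g' τ) 2 volume ≤ G₂')
    (hE : ∃ C : ℝ≥0∞, C < ⊤ ∧ ∀ t ∈ Icc 0 T, ∫⁻ x, ‖u t x‖ₑ ^ 2 ≤ C)
    (hE' : ∃ C : ℝ≥0∞, C < ⊤ ∧ ∀ t ∈ Icc 0 T, ∫⁻ x, ‖u' t x‖ₑ ^ 2 ≤ C)
    (hM : 0 < M) (hM' : 0 < M')
    (hbd : ∀ t ∈ Icc 0 T, ∀ y, ‖u t y‖ ≤ M) (hbd' : ∀ t ∈ Icc 0 T, ∀ y, ‖u' t y‖ ≤ M')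
    (hD : ∀ y, ‖u' 0 y - u 0 y‖ ≤ D) (hF0 : 0 ≤ F)
    (hF : ∀ t ∈ Ioc 0 T, ∀ x, ‖forceDuhamel ν 0 g' t x - forceDuhamel ν 0 g t x‖ ≤ F) :
    ∀ t ∈ Icc 0 T, ∀ x, ‖u' t x - u t x‖ ≤
      2 * (D + F) * Real.exp (36 * C ^ 2 * (M + M') ^ 2 / ν * t) := by
  -- ### constants
  set lam : ℝ := 36 * C ^ 2 * (M + M') ^ 2 / ν with hlam_def
  have hMM : 0 < M + M' := add_pos hM hM'
  have hlam : 0 < lam := by positivity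
  have hD0 : 0 ≤ D := (norm_nonneg _).trans (hD 0)
  -- the key algebraic identity behind the choice of `λ`: `3 C (M+M') (νλ)^{-1/2} = 1/2`
  have hkey : C * (ν ^ (-(1 / 2 : ℝ)) * (3 * lam ^ (-(1 / 2 : ℝ)))) * (M + M') = 1 / 2 := by
    have hνl : ν * lam = (6 * C * (M + M')) ^ 2 := by
      rw [hlam_def]; field_simp; ring
    have h1 : ν ^ (-(1 / 2 : ℝ)) * lam ^ (-(1 / 2 : ℝ)) = (6 * C * (M + M'))⁻¹ := by
      rw [← Real.mul_rpow hν.le hlam.le, hνl, Real.rpow_neg (sq_nonneg _),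
        show ((6 * C * (M + M')) ^ 2) ^ (1 / 2 : ℝ) = 6 * C * (M + M') by
          rw [← Real.sqrt_eq_rpow, Real.sqrt_sq (by positivity)]]
    calc C * (ν ^ (-(1 / 2 : ℝ)) * (3 * lam ^ (-(1 / 2 : ℝ)))) * (M + M')
        = 3 * C * (M + M') * (ν ^ (-(1 / 2 : ℝ)) * lam ^ (-(1 / 2 : ℝ))) := by ring
      _ = 3 * C * (M + M') * (6 * C * (M + M'))⁻¹ := by rw [h1]
      _ = 1 / 2 := by field_simp; ring
  -- ### the difference field and the weighted supremum
  set w : ℝ → EuclideanSpace ℝ (Fin 3) → EuclideanSpace ℝ (Fin 3) := fun τ y => u' τ y - u τ y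
    with hw_def
  have hwbd : ∀ τ ∈ Icc 0 T, ∀ y, ‖w τ y‖ ≤ M' + M := fun τ hτ y =>
    (norm_sub_le _ _).trans (add_le_add (hbd' τ hτ y) (hbd τ hτ y))
  set S : Set ℝ := {r | ∃ τ ∈ Icc 0 T, ∃ y : EuclideanSpace ℝ (Fin 3),
    r = Real.exp (-(lam * τ)) * ‖w τ y‖} with hS_def
  have hSbdd : BddAbove S := by
    refine ⟨M' + M, ?_⟩
    rintro r ⟨τ, hτ, y, rfl⟩
    have he : Real.exp (-(lam * τ)) ≤ 1 := by
      rw [Real.exp_le_one_iff]; nlinarith [hτ.1]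
    calc Real.exp (-(lam * τ)) * ‖w τ y‖ ≤ 1 * (M' + M) :=
          mul_le_mul he (hwbd τ hτ y) (norm_nonneg _) zero_le_one
      _ = M' + M := one_mul _
  have h0I : (0 : ℝ) ∈ Icc 0 T := ⟨le_rfl, hT.le⟩
  have hSne : S.Nonempty := ⟨_, 0, h0I, 0, rfl⟩
  set A : ℝ := sSup S with hA_def
  have hA0 : 0 ≤ A := by
    have hmem : Real.exp (-(lam * 0)) * ‖w 0 0‖ ∈ S := ⟨0, h0I, 0, rfl⟩
    exact le_trans (mul_nonneg (Real.exp_pos _).le (norm_nonneg _)) (le_csSup hSbdd hmem)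
  have hwA : ∀ τ ∈ Icc 0 T, ∀ y, ‖w τ y‖ ≤ A * Real.exp (lam * τ) := by
    intro τ hτ y
    have hmem : Real.exp (-(lam * τ)) * ‖w τ y‖ ∈ S := ⟨τ, hτ, y, rfl⟩
    have h1 : Real.exp (-(lam * τ)) * ‖w τ y‖ ≤ A := le_csSup hSbdd hmem
    have h2 := mul_le_mul_of_nonneg_right h1 (Real.exp_pos (lam * τ)).le
    rwa [mul_assoc, mul_comm ‖w τ y‖, ← mul_assoc, ← Real.exp_add, neg_add_cancel, Real.exp_zero,
      one_mul] at h2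
  -- ### slab regularity
  have hslc : ∀ τ ∈ Icc 0 T, Continuous (u τ) := fun τ hτ => (hcl.contDiff_velocity hτ).continuous
  have hslc' : ∀ τ ∈ Icc 0 T, Continuous (u' τ) := fun τ hτ =>
    (hcl'.contDiff_velocity hτ).continuous
  have hmslc : ∀ τ ∈ Icc 0 T, Measurable (u τ) := fun τ hτ => (hslc τ hτ).measurable
  have hmslc' : ∀ τ ∈ Icc 0 T, Measurable (u' τ) := fun τ hτ => (hslc' τ hτ).measurable
  have hmslcw : ∀ τ ∈ Icc 0 T, Measurable (w τ) := fun τ hτ =>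
    ((hslc' τ hτ).sub (hslc τ hτ)).measurable
  have hmeas : AEStronglyMeasurable (uncurry u)
      ((volume : Measure (ℝ × EuclideanSpace ℝ (Fin 3))).restrict (Ioo 0 T ×ˢ univ)) :=
    (hcl.smooth_velocity.continuousOn.mono (prod_mono Ioo_subset_Icc_self Subset.rfl)).aestronglyMeasurable
      (measurableSet_Ioo.prod MeasurableSet.univ)
  have hmeas' : AEStronglyMeasurable (uncurry u')
      ((volume : Measure (ℝ × EuclideanSpace ℝ (Fin 3))).restrict (Ioo 0 T ×ˢ univ)) :=
    (hcl'.smooth_velocity.continuousOn.mono (prod_mono Ioo_subset_Icc_self Subset.rfl)).aestronglyMeasurable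
      (measurableSet_Ioo.prod MeasurableSet.univ)
  have hmeasw : AEStronglyMeasurable (uncurry w)
      ((volume : Measure (ℝ × EuclideanSpace ℝ (Fin 3))).restrict (Ioo 0 T ×ˢ univ)) :=
    hmeas'.sub hmeas
  have hbdo : ∀ τ ∈ Ioo 0 T, ∀ y, ‖u τ y‖ ≤ M := fun τ hτ => hbd τ ⟨hτ.1.le, hτ.2.le⟩
  have hbdo' : ∀ τ ∈ Ioo 0 T, ∀ y, ‖u' τ y‖ ≤ M' := fun τ hτ => hbd' τ ⟨hτ.1.le, hτ.2.le⟩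
  have hwbdo : ∀ τ ∈ Ioo 0 T, ∀ y, ‖w τ y‖ ≤ M' + M := fun τ hτ => hwbd τ ⟨hτ.1.le, hτ.2.le⟩
  -- ### the pointwise estimate at every `(t, x)` of the slab
  have hpt : ∀ t ∈ Icc 0 T, ∀ x, Real.exp (-(lam * t)) * ‖w t x‖ ≤ (D + F) + A / 2 := by
    intro t ht x
    rcases ht.1.eq_or_lt with h0 | ht0
    · -- `t = 0`
      rw [← h0, mul_zero, neg_zero, Real.exp_zero, one_mul]
      calc ‖w 0 x‖ ≤ D := hD x
        _ ≤ (D + F) + A / 2 := by linarith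
    have htI : t ∈ Ioc 0 T := ⟨ht0, ht.2⟩
    -- the two representations at time `t`
    have hrep := hcl.ae_eq_forced_oseenMild hν hT hgc hG hgdiv hG₂ hg2 hE hM hbd htI
    have hrep' := hcl'.ae_eq_forced_oseenMild hν hT hg'c hG' hg'div hG₂' hg'2 hE' hM' hbd' htI
    -- the bilinear terms
    have hνt : 0 < ν * t := mul_pos hν ht0
    have hBsplit : ∀ y, oseenDuhamel ν 0 u' u' t y - oseenDuhamel ν 0 u u t y =
        oseenDuhamel ν 0 u' w t y + oseenDuhamel ν 0 w u t y := by
      intro y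
      have h1 := oseenDuhamel_sub_right hν hmeas' hmeas' hmeas hbdo' hbdo' hbdo ht0 ht.2 y
      have h2 := oseenDuhamel_sub_left hν hmeas' hmeas hmeas hbdo' hbdo hbdo ht0 ht.2 y
      change oseenDuhamel ν 0 u' w t y = _ at h1
      change oseenDuhamel ν 0 w u t y = _ at h2
      rw [h1, h2]; abel
    obtain ⟨hIw, hIle⟩ := setIntegral_visc_abelKernel_mul_exp_le (K := A) hν hlam ht.1 hA0
    have hwAo : ∀ τ ∈ Ioo 0 t, ∀ y, ‖w τ y‖ ≤ A * Real.exp (lam * τ) := fun τ hτ =>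
      hwA τ ⟨hτ.1.le, hτ.2.le.trans ht.2⟩
    have hB1 : ∀ y, ‖oseenDuhamel ν 0 u' w t y‖ ≤
        C * (M' * (A * ν ^ (-(1 / 2 : ℝ)) * (3 * lam ^ (-(1 / 2 : ℝ)) * Real.exp (lam * t)))) := by
      intro y
      have hint : IntegrableOn
          (fun τ => (ν * (t - τ)) ^ (-(1 / 2 : ℝ)) * (M' * (A * Real.exp (lam * τ)))) (Ioo 0 t) := by
        have := hIw.const_mul M'
        exact IntegrableOn.congr_fun this (fun τ _ => by ring) measurableSet_Ioo
      refine (norm_oseenDuhamel_le_setIntegral_visc_of_sliceBound hC hν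
        (fun τ hτ => hmslc' τ ⟨hτ.1.le, hτ.2.le.trans ht.2⟩)
        (fun τ hτ => hmslcw τ ⟨hτ.1.le, hτ.2.le.trans ht.2⟩)
        (fun τ hτ => hbdo' τ ⟨hτ.1, hτ.2.trans_le ht.2⟩) hwAo hint y).trans ?_
      have heq : ∫ τ in Ioo 0 t, (ν * (t - τ)) ^ (-(1 / 2 : ℝ)) * (M' * (A * Real.exp (lam * τ))) =
          M' * ∫ τ in Ioo 0 t, (ν * (t - τ)) ^ (-(1 / 2 : ℝ)) * (A * Real.exp (lam * τ)) := by
        rw [← integral_const_mul]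
        refine setIntegral_congr_fun measurableSet_Ioo fun τ _ => by ring
      rw [heq]
      exact mul_le_mul_of_nonneg_left (mul_le_mul_of_nonneg_left hIle hM'.le) hC0.le
    have hB2 : ∀ y, ‖oseenDuhamel ν 0 w u t y‖ ≤
        C * ((A * ν ^ (-(1 / 2 : ℝ)) * (3 * lam ^ (-(1 / 2 : ℝ)) * Real.exp (lam * t))) * M) := by
      intro y
      have hint : IntegrableOn
          (fun τ => (ν * (t - τ)) ^ (-(1 / 2 : ℝ)) * ((A * Real.exp (lam * τ)) * M)) (Ioo 0 t) := by
        have := hIw.mul_const M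
        exact IntegrableOn.congr_fun this (fun τ _ => by ring) measurableSet_Ioo
      refine (norm_oseenDuhamel_le_setIntegral_visc_of_sliceBound hC hν
        (fun τ hτ => hmslcw τ ⟨hτ.1.le, hτ.2.le.trans ht.2⟩)
        (fun τ hτ => hmslc τ ⟨hτ.1.le, hτ.2.le.trans ht.2⟩) hwAo
        (fun τ hτ => hbdo τ ⟨hτ.1, hτ.2.trans_le ht.2⟩) hint y).trans ?_
      have heq : ∫ τ in Ioo 0 t, (ν * (t - τ)) ^ (-(1 / 2 : ℝ)) * ((A * Real.exp (lam * τ)) * M) =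
          (∫ τ in Ioo 0 t, (ν * (t - τ)) ^ (-(1 / 2 : ℝ)) * (A * Real.exp (lam * τ))) * M := by
        rw [← integral_mul_const]
        refine setIntegral_congr_fun measurableSet_Ioo fun τ _ => by ring
      rw [heq]
      exact mul_le_mul_of_nonneg_left (mul_le_mul_of_nonneg_right hIle hM.le) hC0.le
    -- the heat term
    have hH : ∀ y, ‖UnboundedOperators.heatExtension (u' 0) (ν * t) y -
        UnboundedOperators.heatExtension (u 0) (ν * t) y‖ ≤ D := by
      intro y
      rw [← UnboundedOperators.heatExtension_sub_of_bound (hslc' 0 h0I) (hslc 0 h0I) (hbd' 0 h0I)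
        (hbd 0 h0I) hνt y]
      exact UnboundedOperators.norm_heatExtension_le hD hνt y
    -- assemble, a.e. in `x`
    have hbound : (D + F) + A / 2 * Real.exp (lam * t) =
        D + (C * (M' * (A * ν ^ (-(1 / 2 : ℝ)) * (3 * lam ^ (-(1 / 2 : ℝ)) * Real.exp (lam * t)))) +
          C * ((A * ν ^ (-(1 / 2 : ℝ)) * (3 * lam ^ (-(1 / 2 : ℝ)) * Real.exp (lam * t))) * M)) + F := by
      have : C * (M' * (A * ν ^ (-(1 / 2 : ℝ)) * (3 * lam ^ (-(1 / 2 : ℝ)) * Real.exp (lam * t)))) +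
          C * ((A * ν ^ (-(1 / 2 : ℝ)) * (3 * lam ^ (-(1 / 2 : ℝ)) * Real.exp (lam * t))) * M) =
          (C * (ν ^ (-(1 / 2 : ℝ)) * (3 * lam ^ (-(1 / 2 : ℝ)))) * (M + M')) * A * Real.exp (lam * t) := by
        ring
      rw [this, hkey]; ring
    have hae : ∀ᵐ y ∂(volume : Measure (EuclideanSpace ℝ (Fin 3))),
        ‖w t y‖ ≤ (D + F) + A / 2 * Real.exp (lam * t) := by
      filter_upwards [hrep, hrep'] with y hy hy'
      have hwy : w t y = (UnboundedOperators.heatExtension (u' 0) (ν * t) y -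
            UnboundedOperators.heatExtension (u 0) (ν * t) y) -
          (oseenDuhamel ν 0 u' u' t y - oseenDuhamel ν 0 u u t y) +
          (forceDuhamel ν 0 g' t y - forceDuhamel ν 0 g t y) := by
        show u' t y - u t y = _
        rw [hy, hy']; abel
      rw [hwy, hBsplit y, hbound]
      calc ‖UnboundedOperators.heatExtension (u' 0) (ν * t) y -
              UnboundedOperators.heatExtension (u 0) (ν * t) y -
            (oseenDuhamel ν 0 u' w t y + oseenDuhamel ν 0 w u t y) +
            (forceDuhamel ν 0 g' t y - forceDuhamel ν 0 g t y)‖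
          ≤ ‖UnboundedOperators.heatExtension (u' 0) (ν * t) y -
              UnboundedOperators.heatExtension (u 0) (ν * t) y -
            (oseenDuhamel ν 0 u' w t y + oseenDuhamel ν 0 w u t y)‖ +
            ‖forceDuhamel ν 0 g' t y - forceDuhamel ν 0 g t y‖ := norm_add_le _ _
        _ ≤ (‖UnboundedOperators.heatExtension (u' 0) (ν * t) y -
              UnboundedOperators.heatExtension (u 0) (ν * t) y‖ +
            ‖oseenDuhamel ν 0 u' w t y + oseenDuhamel ν 0 w u t y‖) +
            ‖forceDuhamel ν 0 g' t y - forceDuhamel ν 0 g t y‖ := by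
            gcongr; exact norm_sub_le _ _
        _ ≤ (D + (‖oseenDuhamel ν 0 u' w t y‖ + ‖oseenDuhamel ν 0 w u t y‖)) + F := by
            gcongr
            · exact hH y
            · exact norm_add_le _ _
            · exact hF t htI y
        _ ≤ (D + (C * (M' * (A * ν ^ (-(1 / 2 : ℝ)) * (3 * lam ^ (-(1 / 2 : ℝ)) * Real.exp (lam * t)))) +
            C * ((A * ν ^ (-(1 / 2 : ℝ)) * (3 * lam ^ (-(1 / 2 : ℝ)) * Real.exp (lam * t))) * M))) + F := by
            gcongr
            · exact hB1 y
            · exact hB2 y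
    have hev : ‖w t x‖ ≤ (D + F) + A / 2 * Real.exp (lam * t) :=
      forall_norm_le_of_ae_norm_le (f := w t) ((hslc' t ht).sub (hslc t ht)) hae x
    -- multiply by the weight
    have hexp : 0 < Real.exp (-(lam * t)) := Real.exp_pos _
    have hexp1 : Real.exp (-(lam * t)) ≤ 1 := by
      rw [Real.exp_le_one_iff]; nlinarith [ht.1]
    calc Real.exp (-(lam * t)) * ‖w t x‖
        ≤ Real.exp (-(lam * t)) * ((D + F) + A / 2 * Real.exp (lam * t)) :=
          mul_le_mul_of_nonneg_left hev hexp.le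
      _ = Real.exp (-(lam * t)) * (D + F) + A / 2 * (Real.exp (-(lam * t)) * Real.exp (lam * t)) := by
          ring
      _ = Real.exp (-(lam * t)) * (D + F) + A / 2 := by
          rw [← Real.exp_add, neg_add_cancel, Real.exp_zero, mul_one]
      _ ≤ 1 * (D + F) + A / 2 := by gcongr
      _ = (D + F) + A / 2 := by rw [one_mul]
  -- ### the weighted supremum is at most `2 (D + F)`
  have hAle : A ≤ (D + F) + A / 2 := by
    refine csSup_le hSne ?_
    rintro r ⟨τ, hτ, y, rfl⟩
    exact hpt τ hτ y
  have hA2 : A ≤ 2 * (D + F) := by linarith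
  -- ### conclusion
  intro t ht x
  have h1 := hwA t ht x
  have hlam_t : lam * t = 36 * C ^ 2 * (M + M') ^ 2 / ν * t := by rw [hlam_def]
  calc ‖u' t x - u t x‖ = ‖w t x‖ := rfl
    _ ≤ A * Real.exp (lam * t) := h1
    _ ≤ 2 * (D + F) * Real.exp (lam * t) :=
        mul_le_mul_of_nonneg_right hA2 (Real.exp_pos _).le
    _ = _ := by rw [hlam_t]

/-- **`L² → L^∞` smoothing of the gap on a short slab, PARAMETRIC in the slice constant** (the
tree's `sup_stability_forced_smoothing_core` with `C₀` replaced by ANY constant `C > 0` satisfying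
the slice bound on measurable bounded fields): same hypotheses as `sup_stability_forced_core_of_sliceBound`
except that the datum gap is measured in `L²` (`‖u'(0) − u(0)‖₂ ≤ E₀`) and the slab is short,
`(24 C (M + M'))² T ≤ ν` ⟹ `‖u'(t,x) − u(t,x)‖ ≤ 2 (E₀ ν^{-3/4} + F T^{3/4}) t^{-3/4}` for
`t ∈ (0, T]`. [cite: Leray1934, §19 (3.4)–(3.8)] [cite: OzanskiPooley2018, (6.65) p. 143 and Lemma 6.5] -/
theorem sup_stability_forced_smoothing_core_of_sliceBound {C : ℝ} (hC0 : 0 < C)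
    (hC : ∀ {σ : ℝ}, 0 < σ → ∀ {a b : EuclideanSpace ℝ (Fin 3) → EuclideanSpace ℝ (Fin 3)} {Ma Mb : ℝ},
      Measurable a → Measurable b → (∀ y, ‖a y‖ ≤ Ma) → (∀ y, ‖b y‖ ≤ Mb) → ∀ x,
        ‖oseenSlice σ a b x‖ ≤ C * σ ^ (-(1 / 2 : ℝ)) * Ma * Mb)
    (hν : 0 < ν) (hT : 0 < T)
    (hcl : IsClassicalNSSolutionOn (Icc 0 T) ν g u p)
    (hcl' : IsClassicalNSSolutionOn (Icc 0 T) ν g' u' p')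
    (hgc : Continuous (uncurry g)) (hg'c : Continuous (uncurry g'))
    (hG : ∀ τ ∈ Icc 0 T, ∀ y, ‖g τ y‖ ≤ G) (hG' : ∀ τ ∈ Icc 0 T, ∀ y, ‖g' τ y‖ ≤ G')
    (hgdiv : ∀ τ ∈ Icc 0 T, IsWeaklyDivFree (g τ)) (hg'div : ∀ τ ∈ Icc 0 T, IsWeaklyDivFree (g' τ))
    (hG₂ : G₂ ≠ ⊤) (hG₂' : G₂' ≠ ⊤)
    (hg2 : ∀ τ ∈ Icc 0 T, eLpNorm (g τ) 2 volume ≤ G₂)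
    (hg'2 : ∀ τ ∈ Icc 0 T, eLpNorm (g' τ) 2 volume ≤ G₂')
    (hE : ∃ C : ℝ≥0∞, C < ⊤ ∧ ∀ t ∈ Icc 0 T, ∫⁻ x, ‖u t x‖ₑ ^ 2 ≤ C)
    (hE' : ∃ C : ℝ≥0∞, C < ⊤ ∧ ∀ t ∈ Icc 0 T, ∫⁻ x, ‖u' t x‖ₑ ^ 2 ≤ C)
    (hM : 0 < M) (hM' : 0 < M')
    (hbd : ∀ t ∈ Icc 0 T, ∀ y, ‖u t y‖ ≤ M) (hbd' : ∀ t ∈ Icc 0 T, ∀ y, ‖u' t y‖ ≤ M')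
    (hTs : (24 * C * (M + M')) ^ 2 * T ≤ ν)
    (hE₀ : 0 ≤ E₀) (hE0 : eLpNorm (fun y => u' 0 y - u 0 y) 2 volume ≤ ENNReal.ofReal E₀)
    (hF0 : 0 ≤ F)
    (hF : ∀ t ∈ Ioc 0 T, ∀ x, ‖forceDuhamel ν 0 g' t x - forceDuhamel ν 0 g t x‖ ≤ F) :
    ∀ t ∈ Ioc 0 T, ∀ x, ‖u' t x - u t x‖ ≤
      2 * (E₀ * ν ^ (-(3 / 4 : ℝ)) + F * T ^ (3 / 4 : ℝ)) * t ^ (-(3 / 4 : ℝ)) := by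
  -- ### constants
  have hMM : 0 < M + M' := add_pos hM hM'
  -- the key inequality behind the shortness of the slab: `12 C (M+M') ν^{-1/2} T^{1/2} ≤ 1/2`
  have hkey : 12 * C * (M + M') * (ν ^ (-(1 / 2 : ℝ)) * T ^ (1 / 2 : ℝ)) ≤ 1 / 2 := by
    have ha : 0 < 24 * C * (M + M') := by positivity
    have h1 : 24 * C * (M + M') * Real.sqrt T ≤ Real.sqrt ν := by
      have h := Real.sqrt_le_sqrt hTs
      rwa [Real.sqrt_mul (sq_nonneg _), Real.sqrt_sq ha.le] at h
    have hsν : 0 < Real.sqrt ν := Real.sqrt_pos.2 hν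
    have h2 : ν ^ (-(1 / 2 : ℝ)) = (Real.sqrt ν)⁻¹ := by
      rw [Real.rpow_neg hν.le, Real.sqrt_eq_rpow]
    rw [h2, ← Real.sqrt_eq_rpow]
    have h3 : 24 * C * (M + M') * Real.sqrt T * (Real.sqrt ν)⁻¹ ≤ 1 := by
      rw [mul_inv_le_iff₀ hsν, one_mul]; exact h1
    calc 12 * C * (M + M') * ((Real.sqrt ν)⁻¹ * Real.sqrt T)
        = (24 * C * (M + M') * Real.sqrt T * (Real.sqrt ν)⁻¹) / 2 := by ring
      _ ≤ 1 / 2 := by linarith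
  -- ### the difference field and the weighted supremum (weight `τ^{3/4}`)
  set w : ℝ → EuclideanSpace ℝ (Fin 3) → EuclideanSpace ℝ (Fin 3) := fun τ y => u' τ y - u τ y
    with hw_def
  have hwbd : ∀ τ ∈ Icc 0 T, ∀ y, ‖w τ y‖ ≤ M' + M := fun τ hτ y =>
    (norm_sub_le _ _).trans (add_le_add (hbd' τ hτ y) (hbd τ hτ y))
  set S : Set ℝ := {r | ∃ τ ∈ Icc 0 T, ∃ y : EuclideanSpace ℝ (Fin 3),
    r = τ ^ (3 / 4 : ℝ) * ‖w τ y‖} with hS_def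
  have hSbdd : BddAbove S := by
    refine ⟨T ^ (3 / 4 : ℝ) * (M' + M), ?_⟩
    rintro r ⟨τ, hτ, y, rfl⟩
    have hτT : τ ^ (3 / 4 : ℝ) ≤ T ^ (3 / 4 : ℝ) := Real.rpow_le_rpow hτ.1 hτ.2 (by norm_num)
    exact mul_le_mul hτT (hwbd τ hτ y) (norm_nonneg _) (Real.rpow_nonneg hT.le _)
  have h0I : (0 : ℝ) ∈ Icc 0 T := ⟨le_rfl, hT.le⟩
  have hSne : S.Nonempty := ⟨_, 0, h0I, 0, rfl⟩
  set A : ℝ := sSup S with hA_def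
  have hA0 : 0 ≤ A := by
    have hmem : (0 : ℝ) ^ (3 / 4 : ℝ) * ‖w 0 0‖ ∈ S := ⟨0, h0I, 0, rfl⟩
    exact le_trans (mul_nonneg (Real.rpow_nonneg le_rfl _) (norm_nonneg _)) (le_csSup hSbdd hmem)
  have hwS : ∀ τ ∈ Icc 0 T, ∀ y, τ ^ (3 / 4 : ℝ) * ‖w τ y‖ ≤ A := fun τ hτ y =>
    le_csSup hSbdd ⟨τ, hτ, y, rfl⟩
  have hwA : ∀ τ ∈ Ioc 0 T, ∀ y, ‖w τ y‖ ≤ A * τ ^ (-(3 / 4 : ℝ)) := by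
    intro τ hτ y
    have hτ34 : 0 < τ ^ (3 / 4 : ℝ) := Real.rpow_pos_of_pos hτ.1 _
    have h1 := hwS τ ⟨hτ.1.le, hτ.2⟩ y
    have h2 : ‖w τ y‖ ≤ A / τ ^ (3 / 4 : ℝ) := by
      rw [le_div_iff₀ hτ34, mul_comm]; exact h1
    rwa [Real.rpow_neg hτ.1.le, ← div_eq_mul_inv]
  -- ### slab regularity
  have hslc : ∀ τ ∈ Icc 0 T, Continuous (u τ) := fun τ hτ => (hcl.contDiff_velocity hτ).continuous
  have hslc' : ∀ τ ∈ Icc 0 T, Continuous (u' τ) := fun τ hτ =>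
    (hcl'.contDiff_velocity hτ).continuous
  have hmslc : ∀ τ ∈ Icc 0 T, Measurable (u τ) := fun τ hτ => (hslc τ hτ).measurable
  have hmslc' : ∀ τ ∈ Icc 0 T, Measurable (u' τ) := fun τ hτ => (hslc' τ hτ).measurable
  have hmslcw : ∀ τ ∈ Icc 0 T, Measurable (w τ) := fun τ hτ =>
    ((hslc' τ hτ).sub (hslc τ hτ)).measurable
  have hmeas : AEStronglyMeasurable (uncurry u)
      ((volume : Measure (ℝ × EuclideanSpace ℝ (Fin 3))).restrict (Ioo 0 T ×ˢ univ)) :=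
    (hcl.smooth_velocity.continuousOn.mono (prod_mono Ioo_subset_Icc_self Subset.rfl)).aestronglyMeasurable
      (measurableSet_Ioo.prod MeasurableSet.univ)
  have hmeas' : AEStronglyMeasurable (uncurry u')
      ((volume : Measure (ℝ × EuclideanSpace ℝ (Fin 3))).restrict (Ioo 0 T ×ˢ univ)) :=
    (hcl'.smooth_velocity.continuousOn.mono (prod_mono Ioo_subset_Icc_self Subset.rfl)).aestronglyMeasurable
      (measurableSet_Ioo.prod MeasurableSet.univ)
  have hmeasw : AEStronglyMeasurable (uncurry w)
      ((volume : Measure (ℝ × EuclideanSpace ℝ (Fin 3))).restrict (Ioo 0 T ×ˢ univ)) :=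
    hmeas'.sub hmeas
  have hbdo : ∀ τ ∈ Ioo 0 T, ∀ y, ‖u τ y‖ ≤ M := fun τ hτ => hbd τ ⟨hτ.1.le, hτ.2.le⟩
  have hbdo' : ∀ τ ∈ Ioo 0 T, ∀ y, ‖u' τ y‖ ≤ M' := fun τ hτ => hbd' τ ⟨hτ.1.le, hτ.2.le⟩
  have hwbdo : ∀ τ ∈ Ioo 0 T, ∀ y, ‖w τ y‖ ≤ M' + M := fun τ hτ => hwbd τ ⟨hτ.1.le, hτ.2.le⟩
  -- the datum gap is in `L²`
  have hw0c : Continuous (w 0) := (hslc' 0 h0I).sub (hslc 0 h0I)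
  have hw0mem : MemLp (w 0) 2 volume :=
    ⟨hw0c.aestronglyMeasurable, hE0.trans_lt ENNReal.ofReal_lt_top⟩
  -- ### the pointwise estimate at every `(t, x)` of the slab
  have hpt : ∀ t ∈ Icc 0 T, ∀ x, t ^ (3 / 4 : ℝ) * ‖w t x‖ ≤
      (E₀ * ν ^ (-(3 / 4 : ℝ)) + F * T ^ (3 / 4 : ℝ)) + A / 2 := by
    intro t ht x
    have hRHS0 : 0 ≤ (E₀ * ν ^ (-(3 / 4 : ℝ)) + F * T ^ (3 / 4 : ℝ)) + A / 2 := by positivity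
    rcases ht.1.eq_or_lt with h0 | ht0
    · -- `t = 0`: the weight vanishes
      rw [← h0, Real.zero_rpow (by norm_num), zero_mul]
      exact hRHS0
    have htI : t ∈ Ioc 0 T := ⟨ht0, ht.2⟩
    -- the two representations at time `t`
    have hrep := hcl.ae_eq_forced_oseenMild hν hT hgc hG hgdiv hG₂ hg2 hE hM hbd htI
    have hrep' := hcl'.ae_eq_forced_oseenMild hν hT hg'c hG' hg'div hG₂' hg'2 hE' hM' hbd' htI
    -- the bilinear terms
    have hνt : 0 < ν * t := mul_pos hν ht0
    have hBsplit : ∀ y, oseenDuhamel ν 0 u' u' t y - oseenDuhamel ν 0 u u t y =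
        oseenDuhamel ν 0 u' w t y + oseenDuhamel ν 0 w u t y := by
      intro y
      have h1 := oseenDuhamel_sub_right hν hmeas' hmeas' hmeas hbdo' hbdo' hbdo ht0 ht.2 y
      have h2 := oseenDuhamel_sub_left hν hmeas' hmeas hmeas hbdo' hbdo hbdo ht0 ht.2 y
      change oseenDuhamel ν 0 u' w t y = _ at h1
      change oseenDuhamel ν 0 w u t y = _ at h2
      rw [h1, h2]; abel
    have hwAo : ∀ τ ∈ Ioo 0 t, ∀ y, ‖w τ y‖ ≤ A * τ ^ (-(3 / 4 : ℝ)) := fun τ hτ =>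
      hwA τ ⟨hτ.1, hτ.2.le.trans ht.2⟩
    have hB1 : ∀ y, ‖oseenDuhamel ν 0 u' w t y‖ ≤
        C * ((M' * A) * ν ^ (-(1 / 2 : ℝ)) * (12 * t ^ (-(1 / 4 : ℝ)))) := by
      intro y
      obtain ⟨hIw, hIle⟩ := setIntegral_visc_abelKernel_mul_rpow_threeQuarter_le (K := M' * A) hν ht0
        (mul_nonneg hM'.le hA0)
      have hint : IntegrableOn
          (fun τ => (ν * (t - τ)) ^ (-(1 / 2 : ℝ)) * (M' * (A * τ ^ (-(3 / 4 : ℝ))))) (Ioo 0 t) :=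
        IntegrableOn.congr_fun hIw (fun τ _ => by ring) measurableSet_Ioo
      refine (norm_oseenDuhamel_le_setIntegral_visc_of_sliceBound hC hν
        (fun τ hτ => hmslc' τ ⟨hτ.1.le, hτ.2.le.trans ht.2⟩)
        (fun τ hτ => hmslcw τ ⟨hτ.1.le, hτ.2.le.trans ht.2⟩)
        (fun τ hτ => hbdo' τ ⟨hτ.1, hτ.2.trans_le ht.2⟩) hwAo hint y).trans ?_
      have heq : ∫ τ in Ioo 0 t, (ν * (t - τ)) ^ (-(1 / 2 : ℝ)) * (M' * (A * τ ^ (-(3 / 4 : ℝ)))) =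
          ∫ τ in Ioo 0 t, (ν * (t - τ)) ^ (-(1 / 2 : ℝ)) * ((M' * A) * τ ^ (-(3 / 4 : ℝ))) :=
        setIntegral_congr_fun measurableSet_Ioo fun τ _ => by ring
      rw [heq]
      exact mul_le_mul_of_nonneg_left hIle hC0.le
    have hB2 : ∀ y, ‖oseenDuhamel ν 0 w u t y‖ ≤
        C * ((A * M) * ν ^ (-(1 / 2 : ℝ)) * (12 * t ^ (-(1 / 4 : ℝ)))) := by
      intro y
      obtain ⟨hIw, hIle⟩ := setIntegral_visc_abelKernel_mul_rpow_threeQuarter_le (K := A * M) hν ht0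
        (mul_nonneg hA0 hM.le)
      have hint : IntegrableOn
          (fun τ => (ν * (t - τ)) ^ (-(1 / 2 : ℝ)) * ((A * τ ^ (-(3 / 4 : ℝ))) * M)) (Ioo 0 t) :=
        IntegrableOn.congr_fun hIw (fun τ _ => by ring) measurableSet_Ioo
      refine (norm_oseenDuhamel_le_setIntegral_visc_of_sliceBound hC hν
        (fun τ hτ => hmslcw τ ⟨hτ.1.le, hτ.2.le.trans ht.2⟩)
        (fun τ hτ => hmslc τ ⟨hτ.1.le, hτ.2.le.trans ht.2⟩) hwAo
        (fun τ hτ => hbdo τ ⟨hτ.1, hτ.2.trans_le ht.2⟩) hint y).trans ?_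
      have heq : ∫ τ in Ioo 0 t, (ν * (t - τ)) ^ (-(1 / 2 : ℝ)) * ((A * τ ^ (-(3 / 4 : ℝ))) * M) =
          ∫ τ in Ioo 0 t, (ν * (t - τ)) ^ (-(1 / 2 : ℝ)) * ((A * M) * τ ^ (-(3 / 4 : ℝ))) :=
        setIntegral_congr_fun measurableSet_Ioo fun τ _ => by ring
      rw [heq]
      exact mul_le_mul_of_nonneg_left hIle hC0.le
    -- the heat term: `L² → L^∞` smoothing of the datum gap
    have hH : ∀ y, ‖UnboundedOperators.heatExtension (u' 0) (ν * t) y -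
        UnboundedOperators.heatExtension (u 0) (ν * t) y‖ ≤ E₀ * (ν * t) ^ (-(3 / 4 : ℝ)) := by
      intro y
      rw [← UnboundedOperators.heatExtension_sub_of_bound (hslc' 0 h0I) (hslc 0 h0I) (hbd' 0 h0I)
        (hbd 0 h0I) hνt y]
      exact norm_heatExtension_le_of_eLpNorm_two hw0mem hE₀ hE0 hνt y
    -- assemble, a.e. in `x`
    set Bt : ℝ := C * ((M' * A) * ν ^ (-(1 / 2 : ℝ)) * (12 * t ^ (-(1 / 4 : ℝ)))) +
      C * ((A * M) * ν ^ (-(1 / 2 : ℝ)) * (12 * t ^ (-(1 / 4 : ℝ)))) with hBt_def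
    have hBt : Bt = (12 * C * (M + M') * ν ^ (-(1 / 2 : ℝ))) * t ^ (-(1 / 4 : ℝ)) * A := by
      rw [hBt_def]; ring
    have hae : ∀ᵐ y ∂(volume : Measure (EuclideanSpace ℝ (Fin 3))),
        ‖w t y‖ ≤ E₀ * (ν * t) ^ (-(3 / 4 : ℝ)) + Bt + F := by
      filter_upwards [hrep, hrep'] with y hy hy'
      have hwy : w t y = (UnboundedOperators.heatExtension (u' 0) (ν * t) y -
            UnboundedOperators.heatExtension (u 0) (ν * t) y) -
          (oseenDuhamel ν 0 u' u' t y - oseenDuhamel ν 0 u u t y) +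
          (forceDuhamel ν 0 g' t y - forceDuhamel ν 0 g t y) := by
        show u' t y - u t y = _
        rw [hy, hy']; abel
      rw [hwy, hBsplit y, hBt_def]
      calc ‖UnboundedOperators.heatExtension (u' 0) (ν * t) y -
              UnboundedOperators.heatExtension (u 0) (ν * t) y -
            (oseenDuhamel ν 0 u' w t y + oseenDuhamel ν 0 w u t y) +
            (forceDuhamel ν 0 g' t y - forceDuhamel ν 0 g t y)‖
          ≤ ‖UnboundedOperators.heatExtension (u' 0) (ν * t) y -
              UnboundedOperators.heatExtension (u 0) (ν * t) y -
            (oseenDuhamel ν 0 u' w t y + oseenDuhamel ν 0 w u t y)‖ +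
            ‖forceDuhamel ν 0 g' t y - forceDuhamel ν 0 g t y‖ := norm_add_le _ _
        _ ≤ (‖UnboundedOperators.heatExtension (u' 0) (ν * t) y -
              UnboundedOperators.heatExtension (u 0) (ν * t) y‖ +
            ‖oseenDuhamel ν 0 u' w t y + oseenDuhamel ν 0 w u t y‖) +
            ‖forceDuhamel ν 0 g' t y - forceDuhamel ν 0 g t y‖ := by
            gcongr; exact norm_sub_le _ _
        _ ≤ (E₀ * (ν * t) ^ (-(3 / 4 : ℝ)) +
            (‖oseenDuhamel ν 0 u' w t y‖ + ‖oseenDuhamel ν 0 w u t y‖)) + F := by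
            gcongr
            · exact hH y
            · exact norm_add_le _ _
            · exact hF t htI y
        _ ≤ (E₀ * (ν * t) ^ (-(3 / 4 : ℝ)) +
            (C * ((M' * A) * ν ^ (-(1 / 2 : ℝ)) * (12 * t ^ (-(1 / 4 : ℝ)))) +
              C * ((A * M) * ν ^ (-(1 / 2 : ℝ)) * (12 * t ^ (-(1 / 4 : ℝ)))))) + F := by
            gcongr
            · exact hB1 y
            · exact hB2 y
        _ = _ := by ring
    have hev : ‖w t x‖ ≤ E₀ * (ν * t) ^ (-(3 / 4 : ℝ)) + Bt + F :=
      forall_norm_le_of_ae_norm_le (f := w t) ((hslc' t ht).sub (hslc t ht)) hae x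
    -- multiply by the weight `t^{3/4}`
    have ht34 : 0 < t ^ (3 / 4 : ℝ) := Real.rpow_pos_of_pos ht0 _
    have hνt34 : (ν * t) ^ (-(3 / 4 : ℝ)) = ν ^ (-(3 / 4 : ℝ)) * t ^ (-(3 / 4 : ℝ)) :=
      Real.mul_rpow hν.le ht0.le
    have hcancel : t ^ (3 / 4 : ℝ) * t ^ (-(3 / 4 : ℝ)) = 1 := by
      rw [← Real.rpow_add ht0, show (3 / 4 : ℝ) + -(3 / 4 : ℝ) = 0 by norm_num, Real.rpow_zero]
    have hhalf : t ^ (3 / 4 : ℝ) * t ^ (-(1 / 4 : ℝ)) = t ^ (1 / 2 : ℝ) := by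
      rw [← Real.rpow_add ht0]; norm_num
    have ht12 : t ^ (1 / 2 : ℝ) ≤ T ^ (1 / 2 : ℝ) := Real.rpow_le_rpow ht0.le ht.2 (by norm_num)
    have ht34le : t ^ (3 / 4 : ℝ) ≤ T ^ (3 / 4 : ℝ) := Real.rpow_le_rpow ht0.le ht.2 (by norm_num)
    have hcoef0 : 0 ≤ 12 * C * (M + M') * ν ^ (-(1 / 2 : ℝ)) := by positivity
    -- the three weighted terms
    have hT1 : t ^ (3 / 4 : ℝ) * (E₀ * (ν * t) ^ (-(3 / 4 : ℝ))) = E₀ * ν ^ (-(3 / 4 : ℝ)) := by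
      rw [hνt34]
      calc t ^ (3 / 4 : ℝ) * (E₀ * (ν ^ (-(3 / 4 : ℝ)) * t ^ (-(3 / 4 : ℝ))))
          = E₀ * ν ^ (-(3 / 4 : ℝ)) * (t ^ (3 / 4 : ℝ) * t ^ (-(3 / 4 : ℝ))) := by ring
        _ = E₀ * ν ^ (-(3 / 4 : ℝ)) := by rw [hcancel, mul_one]
    have hT2 : t ^ (3 / 4 : ℝ) * Bt ≤ A / 2 := by
      rw [hBt]
      calc t ^ (3 / 4 : ℝ) * ((12 * C * (M + M') * ν ^ (-(1 / 2 : ℝ))) * t ^ (-(1 / 4 : ℝ)) * A)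
          = (12 * C * (M + M') * ν ^ (-(1 / 2 : ℝ))) * (t ^ (3 / 4 : ℝ) * t ^ (-(1 / 4 : ℝ))) * A := by
            ring
        _ = (12 * C * (M + M') * ν ^ (-(1 / 2 : ℝ))) * t ^ (1 / 2 : ℝ) * A := by rw [hhalf]
        _ ≤ (12 * C * (M + M') * ν ^ (-(1 / 2 : ℝ))) * T ^ (1 / 2 : ℝ) * A := by gcongr
        _ = (12 * C * (M + M') * (ν ^ (-(1 / 2 : ℝ)) * T ^ (1 / 2 : ℝ))) * A := by ring
        _ ≤ (1 / 2) * A := mul_le_mul_of_nonneg_right hkey hA0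
        _ = A / 2 := by ring
    have hT3 : t ^ (3 / 4 : ℝ) * F ≤ F * T ^ (3 / 4 : ℝ) := by
      rw [mul_comm]; exact mul_le_mul_of_nonneg_left ht34le hF0
    calc t ^ (3 / 4 : ℝ) * ‖w t x‖
        ≤ t ^ (3 / 4 : ℝ) * (E₀ * (ν * t) ^ (-(3 / 4 : ℝ)) + Bt + F) :=
          mul_le_mul_of_nonneg_left hev ht34.le
      _ = t ^ (3 / 4 : ℝ) * (E₀ * (ν * t) ^ (-(3 / 4 : ℝ))) + t ^ (3 / 4 : ℝ) * Bt +
            t ^ (3 / 4 : ℝ) * F := by ring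
      _ ≤ E₀ * ν ^ (-(3 / 4 : ℝ)) + A / 2 + F * T ^ (3 / 4 : ℝ) := by
          rw [hT1]; gcongr
      _ = (E₀ * ν ^ (-(3 / 4 : ℝ)) + F * T ^ (3 / 4 : ℝ)) + A / 2 := by ring
  -- ### the weighted supremum is at most `2 (E₀ ν^{-3/4} + F T^{3/4})`
  have hAle : A ≤ (E₀ * ν ^ (-(3 / 4 : ℝ)) + F * T ^ (3 / 4 : ℝ)) + A / 2 := by
    refine csSup_le hSne ?_
    rintro r ⟨τ, hτ, y, rfl⟩
    exact hpt τ hτ y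
  have hA2 : A ≤ 2 * (E₀ * ν ^ (-(3 / 4 : ℝ)) + F * T ^ (3 / 4 : ℝ)) := by linarith
  -- ### conclusion
  intro t ht x
  calc ‖u' t x - u t x‖ = ‖w t x‖ := rfl
    _ ≤ A * t ^ (-(3 / 4 : ℝ)) := hwA t ht x
    _ ≤ 2 * (E₀ * ν ^ (-(3 / 4 : ℝ)) + F * T ^ (3 / 4 : ℝ)) * t ^ (-(3 / 4 : ℝ)) :=
        mul_le_mul_of_nonneg_right hA2 (Real.rpow_nonneg ht.1.le _)

end Core

/-! ### The explicit instances (`C = 8829`) -/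

section Explicit

variable {ν T s M M' D E₀ Es F : ℝ}
  {g g' u u' : ℝ → EuclideanSpace ℝ (Fin 3) → EuclideanSpace ℝ (Fin 3)}
  {p p' : ℝ → EuclideanSpace ℝ (Fin 3) → ℝ} {G G' : ℝ} {G₂ G₂' : ℝ≥0∞}

/-- **Sup-norm stability with an EXPLICIT fee**: under the hypotheses of
`sup_stability_forced_core` (two bounded classical finite-energy forced solutions on `[0,T] × ℝ³`,
sup datum gap `≤ D`, force-Duhamel gap `≤ F`), for all `t ∈ [0, T]` and all `x`:
`‖u'(t,x) − u(t,x)‖ ≤ 2 (D + F) exp (36 · 8829² (M + M')² t / ν)`.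
[cite: Leray1934, §19 (3.4)–(3.8)] [cite: LemarieRieusset2016, Thm. 6.1 (6.12) with Prop. 6.5] -/
theorem sup_stability_forced_core_explicit (hν : 0 < ν) (hT : 0 < T)
    (hcl : IsClassicalNSSolutionOn (Icc 0 T) ν g u p)
    (hcl' : IsClassicalNSSolutionOn (Icc 0 T) ν g' u' p')
    (hgc : Continuous (uncurry g)) (hg'c : Continuous (uncurry g'))
    (hG : ∀ τ ∈ Icc 0 T, ∀ y, ‖g τ y‖ ≤ G) (hG' : ∀ τ ∈ Icc 0 T, ∀ y, ‖g' τ y‖ ≤ G')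
    (hgdiv : ∀ τ ∈ Icc 0 T, IsWeaklyDivFree (g τ)) (hg'div : ∀ τ ∈ Icc 0 T, IsWeaklyDivFree (g' τ))
    (hG₂ : G₂ ≠ ⊤) (hG₂' : G₂' ≠ ⊤)
    (hg2 : ∀ τ ∈ Icc 0 T, eLpNorm (g τ) 2 volume ≤ G₂)
    (hg'2 : ∀ τ ∈ Icc 0 T, eLpNorm (g' τ) 2 volume ≤ G₂')
    (hE : ∃ C : ℝ≥0∞, C < ⊤ ∧ ∀ t ∈ Icc 0 T, ∫⁻ x, ‖u t x‖ₑ ^ 2 ≤ C)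
    (hE' : ∃ C : ℝ≥0∞, C < ⊤ ∧ ∀ t ∈ Icc 0 T, ∫⁻ x, ‖u' t x‖ₑ ^ 2 ≤ C)
    (hM : 0 < M) (hM' : 0 < M')
    (hbd : ∀ t ∈ Icc 0 T, ∀ y, ‖u t y‖ ≤ M) (hbd' : ∀ t ∈ Icc 0 T, ∀ y, ‖u' t y‖ ≤ M')
    (hD : ∀ y, ‖u' 0 y - u 0 y‖ ≤ D) (hF0 : 0 ≤ F)
    (hF : ∀ t ∈ Ioc 0 T, ∀ x, ‖forceDuhamel ν 0 g' t x - forceDuhamel ν 0 g t x‖ ≤ F) :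
    ∀ t ∈ Icc 0 T, ∀ x, ‖u' t x - u t x‖ ≤
      2 * (D + F) * Real.exp (36 * (8829 : ℝ) ^ 2 * (M + M') ^ 2 / ν * t) :=
  sup_stability_forced_core_of_sliceBound (by norm_num)
    (fun {σ} hσ {a} {b} {Ma} {Mb} ham hbm ha hb x => norm_oseenSlice_le_explicit_three hσ ham hbm ha hb x)
    hν hT hcl hcl' hgc hg'c hG hG' hgdiv hg'div hG₂ hG₂' hg2 hg'2 hE hE' hM hM' hbd hbd' hD hF0 hF

/-- **Sup-norm stability of an UNFORCED bounded classical solution under a small force measured in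
`L²`, EXPLICIT fee** (the initial layer of a certificate argument: `u` an exact free run, `u'` a
pseudo-run driven by its defect `g'`, equal or `D`-close data): for all `t ∈ [0, T]` and all `x`,
`‖u'(t,x) − u(t,x)‖ ≤ 2 (D + 4 ν^{-3/4} T^{1/4} sup‖g'‖₂) exp (36 · 8829² (M + M')² t / ν)`.
[cite: Leray1934, §19 (3.4)–(3.8)] [cite: LemarieRieusset2016, Thm. 6.1 (6.12) with Prop. 6.5] -/
theorem sup_stability_forced_free_explicit (hν : 0 < ν) (hT : 0 < T)
    (hcl : IsClassicalNSSolutionOn (Icc 0 T) ν 0 u p)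
    (hcl' : IsClassicalNSSolutionOn (Icc 0 T) ν g' u' p')
    (hg'c : Continuous (uncurry g'))
    (hG' : ∀ τ ∈ Icc 0 T, ∀ y, ‖g' τ y‖ ≤ G')
    (hg'div : ∀ τ ∈ Icc 0 T, IsWeaklyDivFree (g' τ)) {G₂r : ℝ} (hG₂r : 0 ≤ G₂r)
    (hg'2 : ∀ τ ∈ Icc 0 T, eLpNorm (g' τ) 2 volume ≤ ENNReal.ofReal G₂r)
    (hE : ∃ C : ℝ≥0∞, C < ⊤ ∧ ∀ t ∈ Icc 0 T, ∫⁻ x, ‖u t x‖ₑ ^ 2 ≤ C)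
    (hE' : ∃ C : ℝ≥0∞, C < ⊤ ∧ ∀ t ∈ Icc 0 T, ∫⁻ x, ‖u' t x‖ₑ ^ 2 ≤ C)
    (hM : 0 < M) (hM' : 0 < M')
    (hbd : ∀ t ∈ Icc 0 T, ∀ y, ‖u t y‖ ≤ M) (hbd' : ∀ t ∈ Icc 0 T, ∀ y, ‖u' t y‖ ≤ M')
    (hD : ∀ y, ‖u' 0 y - u 0 y‖ ≤ D) :
    ∀ t ∈ Icc 0 T, ∀ x, ‖u' t x - u t x‖ ≤
      2 * (D + 4 * ν ^ (-(3 / 4 : ℝ)) * T ^ (1 / 4 : ℝ) * G₂r) *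
        Real.exp (36 * (8829 : ℝ) ^ 2 * (M + M') ^ 2 / ν * t) := by
  have hgc : Continuous (uncurry (0 : ℝ → EuclideanSpace ℝ (Fin 3) → EuclideanSpace ℝ (Fin 3))) :=
    continuous_const
  have hG : ∀ τ ∈ Icc 0 T, ∀ y,
      ‖(0 : ℝ → EuclideanSpace ℝ (Fin 3) → EuclideanSpace ℝ (Fin 3)) τ y‖ ≤ 0 := fun τ _ y => by simp
  have hgdiv : ∀ τ ∈ Icc 0 T,
      IsWeaklyDivFree ((0 : ℝ → EuclideanSpace ℝ (Fin 3) → EuclideanSpace ℝ (Fin 3)) τ) :=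
    fun τ _ θ _ => by simp
  have hg2 : ∀ τ ∈ Icc 0 T,
      eLpNorm ((0 : ℝ → EuclideanSpace ℝ (Fin 3) → EuclideanSpace ℝ (Fin 3)) τ) 2 volume ≤ (0 : ℝ≥0∞) :=
    fun τ _ => by simp
  have hg'slc : ∀ τ, Continuous (g' τ) := fun τ => hg'c.comp (continuous_const.prodMk continuous_id)
  have hg'mem : ∀ τ ∈ Icc 0 T, MemLp (g' τ) 2 volume := fun τ hτ =>
    ⟨(hg'slc τ).aestronglyMeasurable, (hg'2 τ hτ).trans_lt ENNReal.ofReal_lt_top⟩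
  have hD0 : 0 ≤ D := (norm_nonneg _).trans (hD 0)
  refine sup_stability_forced_core_explicit hν hT hcl hcl' hgc hg'c hG hG' hgdiv hg'div
    ENNReal.zero_ne_top ENNReal.ofReal_ne_top hg2 hg'2 hE hE' hM hM' hbd hbd' hD (by positivity) ?_
  intro t ht x
  have h0 : forceDuhamel ν 0 (0 : ℝ → EuclideanSpace ℝ (Fin 3) → EuclideanSpace ℝ (Fin 3)) t x = 0 := by
    rw [forceDuhamel_apply]
    have hz : ∀ τ, UnboundedOperators.heatExtension
        ((0 : ℝ → EuclideanSpace ℝ (Fin 3) → EuclideanSpace ℝ (Fin 3)) τ) (ν * (t - τ)) x = 0 := by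
      intro τ
      have : ((0 : ℝ → EuclideanSpace ℝ (Fin 3) → EuclideanSpace ℝ (Fin 3)) τ) =
          fun _ : EuclideanSpace ℝ (Fin 3) => (0 : EuclideanSpace ℝ (Fin 3)) := rfl
      rw [this, UnboundedOperators.heatExtension_zero_fun]; rfl
    simp_rw [hz, integral_zero]
  rw [h0, sub_zero]
  refine (norm_forceDuhamel_le_of_eLpNorm_two hν ht.1 hG₂r
    (fun τ hτ => hg'mem τ ⟨hτ.1.le, hτ.2.le.trans ht.2⟩)
    (fun τ hτ => hg'2 τ ⟨hτ.1.le, hτ.2.le.trans ht.2⟩) x).trans ?_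
  have ht4 : t ^ (1 / 4 : ℝ) ≤ T ^ (1 / 4 : ℝ) := Real.rpow_le_rpow ht.1.le ht.2 (by norm_num)
  have hν34 : 0 ≤ 4 * ν ^ (-(3 / 4 : ℝ)) := by positivity
  gcongr

/-- **`L² → L^∞` smoothing of the gap on a short slab, EXPLICIT shortness**: under the hypotheses
of `sup_stability_forced_smoothing_core` with the shortness condition `(24 · 8829 (M + M'))² T ≤ ν`
(in place of the unexplicit `C₀`), for all `t ∈ (0, T]` and all `x`:
`‖u'(t,x) − u(t,x)‖ ≤ 2 (E₀ ν^{-3/4} + F T^{3/4}) t^{-3/4}`.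
[cite: Leray1934, §19 (3.4)–(3.8)] [cite: OzanskiPooley2018, (6.65) p. 143 and Lemma 6.5] -/
theorem sup_stability_forced_smoothing_core_explicit (hν : 0 < ν) (hT : 0 < T)
    (hcl : IsClassicalNSSolutionOn (Icc 0 T) ν g u p)
    (hcl' : IsClassicalNSSolutionOn (Icc 0 T) ν g' u' p')
    (hgc : Continuous (uncurry g)) (hg'c : Continuous (uncurry g'))
    (hG : ∀ τ ∈ Icc 0 T, ∀ y, ‖g τ y‖ ≤ G) (hG' : ∀ τ ∈ Icc 0 T, ∀ y, ‖g' τ y‖ ≤ G')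
    (hgdiv : ∀ τ ∈ Icc 0 T, IsWeaklyDivFree (g τ)) (hg'div : ∀ τ ∈ Icc 0 T, IsWeaklyDivFree (g' τ))
    (hG₂ : G₂ ≠ ⊤) (hG₂' : G₂' ≠ ⊤)
    (hg2 : ∀ τ ∈ Icc 0 T, eLpNorm (g τ) 2 volume ≤ G₂)
    (hg'2 : ∀ τ ∈ Icc 0 T, eLpNorm (g' τ) 2 volume ≤ G₂')
    (hE : ∃ C : ℝ≥0∞, C < ⊤ ∧ ∀ t ∈ Icc 0 T, ∫⁻ x, ‖u t x‖ₑ ^ 2 ≤ C)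
    (hE' : ∃ C : ℝ≥0∞, C < ⊤ ∧ ∀ t ∈ Icc 0 T, ∫⁻ x, ‖u' t x‖ₑ ^ 2 ≤ C)
    (hM : 0 < M) (hM' : 0 < M')
    (hbd : ∀ t ∈ Icc 0 T, ∀ y, ‖u t y‖ ≤ M) (hbd' : ∀ t ∈ Icc 0 T, ∀ y, ‖u' t y‖ ≤ M')
    (hTs : (24 * (8829 : ℝ) * (M + M')) ^ 2 * T ≤ ν)
    (hE₀ : 0 ≤ E₀) (hE0 : eLpNorm (fun y => u' 0 y - u 0 y) 2 volume ≤ ENNReal.ofReal E₀)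
    (hF0 : 0 ≤ F)
    (hF : ∀ t ∈ Ioc 0 T, ∀ x, ‖forceDuhamel ν 0 g' t x - forceDuhamel ν 0 g t x‖ ≤ F) :
    ∀ t ∈ Ioc 0 T, ∀ x, ‖u' t x - u t x‖ ≤
      2 * (E₀ * ν ^ (-(3 / 4 : ℝ)) + F * T ^ (3 / 4 : ℝ)) * t ^ (-(3 / 4 : ℝ)) :=
  sup_stability_forced_smoothing_core_of_sliceBound (by norm_num)
    (fun {σ} hσ {a} {b} {Ma} {Mb} ham hbm ha hb x => norm_oseenSlice_le_explicit_three hσ ham hbm ha hb x)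
    hν hT hcl hcl' hgc hg'c hG hG' hgdiv hg'div hG₂ hG₂' hg2 hg'2 hE hE' hM hM' hbd hbd' hTs hE₀ hE0
    hF0 hF

/-- **`L² → L^∞` smoothing on a SHORT TERMINAL WINDOW `[s, T]`, EXPLICIT shortness** (the form a
certificate consumes): `(u, p)` unforced and `(u', p')` forced by `g'` (jointly continuous,
bounded, weakly divergence-free slices, `‖g'(τ)‖₂ ≤ G₂'`), both classical with finite energy on
`[0, T] × ℝ³` and bounded by `M`, `M'`; `0 ≤ s < T` with `(24 · 8829 (M + M'))² (T − s) ≤ ν`; if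
`‖u'(s,·) − u(s,·)‖₂ ≤ E_s` then for all `t ∈ (s, T]` and all `x`:
`‖u'(t,x) − u(t,x)‖ ≤ 2 (E_s ν^{-3/4} + 4 ν^{-3/4} (T−s)^{1/4} G₂' · (T−s)^{3/4}) (t − s)^{-3/4}`.
[cite: Leray1934, §19 (3.4)–(3.8)] [cite: OzanskiPooley2018, (6.65) p. 143 and Lemma 6.5] -/
theorem sup_stability_forced_smoothing_free_window_explicit (hν : 0 < ν) (hs0 : 0 ≤ s) (hsT : s < T)
    (hcl : IsClassicalNSSolutionOn (Icc 0 T) ν 0 u p)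
    (hcl' : IsClassicalNSSolutionOn (Icc 0 T) ν g' u' p')
    (hg'c : Continuous (uncurry g'))
    (hG' : ∀ τ ∈ Icc 0 T, ∀ y, ‖g' τ y‖ ≤ G')
    (hg'div : ∀ τ ∈ Icc 0 T, IsWeaklyDivFree (g' τ)) {G₂r : ℝ} (hG₂r : 0 ≤ G₂r)
    (hg'2 : ∀ τ ∈ Icc 0 T, eLpNorm (g' τ) 2 volume ≤ ENNReal.ofReal G₂r)
    (hE : ∃ C : ℝ≥0∞, C < ⊤ ∧ ∀ t ∈ Icc 0 T, ∫⁻ x, ‖u t x‖ₑ ^ 2 ≤ C)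
    (hE' : ∃ C : ℝ≥0∞, C < ⊤ ∧ ∀ t ∈ Icc 0 T, ∫⁻ x, ‖u' t x‖ₑ ^ 2 ≤ C)
    (hM : 0 < M) (hM' : 0 < M')
    (hbd : ∀ t ∈ Icc 0 T, ∀ y, ‖u t y‖ ≤ M) (hbd' : ∀ t ∈ Icc 0 T, ∀ y, ‖u' t y‖ ≤ M')
    (hTs : (24 * (8829 : ℝ) * (M + M')) ^ 2 * (T - s) ≤ ν)
    (hEs0 : 0 ≤ Es) (hEs : eLpNorm (fun y => u' s y - u s y) 2 volume ≤ ENNReal.ofReal Es) :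
    ∀ t ∈ Ioc s T, ∀ x, ‖u' t x - u t x‖ ≤
      2 * (Es * ν ^ (-(3 / 4 : ℝ)) +
          4 * ν ^ (-(3 / 4 : ℝ)) * (T - s) ^ (1 / 4 : ℝ) * G₂r * (T - s) ^ (3 / 4 : ℝ)) *
        (t - s) ^ (-(3 / 4 : ℝ)) := by
  have hTs' : 0 < T - s := sub_pos.2 hsT
  -- the translated solutions on `[0, T - s]`
  have hmem : ∀ τ ∈ Icc 0 (T - s), τ + s ∈ Icc 0 T := fun τ hτ =>
    ⟨by linarith [hτ.1], by linarith [hτ.2]⟩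
  have hUD : UniqueDiffOn ℝ (Icc 0 (T - s)) := uniqueDiffOn_Icc hTs'
  have hclT : IsClassicalNSSolutionOn (Icc 0 (T - s)) ν 0 (fun t => u (t + s)) (fun t => p (t + s)) :=
    (hcl.comp_add_right s).mono (fun t ht => hmem t ht) hUD
  have hclT' : IsClassicalNSSolutionOn (Icc 0 (T - s)) ν (fun t => g' (t + s)) (fun t => u' (t + s))
      (fun t => p' (t + s)) :=
    (hcl'.comp_add_right s).mono (fun t ht => hmem t ht) hUD
  have hg'cT : Continuous (uncurry fun t => g' (t + s)) :=
    hg'c.comp ((continuous_fst.add continuous_const).prodMk continuous_snd)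
  have hG'T : ∀ τ ∈ Icc 0 (T - s), ∀ y, ‖g' (τ + s) y‖ ≤ G' := fun τ hτ => hG' _ (hmem τ hτ)
  have hg'divT : ∀ τ ∈ Icc 0 (T - s), IsWeaklyDivFree (g' (τ + s)) := fun τ hτ =>
    hg'div _ (hmem τ hτ)
  have hg'2T : ∀ τ ∈ Icc 0 (T - s), eLpNorm (g' (τ + s)) 2 volume ≤ ENNReal.ofReal G₂r :=
    fun τ hτ => hg'2 _ (hmem τ hτ)
  have hET : ∃ C : ℝ≥0∞, C < ⊤ ∧ ∀ t ∈ Icc 0 (T - s), ∫⁻ x, ‖u (t + s) x‖ₑ ^ 2 ≤ C := by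
    obtain ⟨C, hC, h⟩ := hE
    exact ⟨C, hC, fun t ht => h _ (hmem t ht)⟩
  have hET' : ∃ C : ℝ≥0∞, C < ⊤ ∧ ∀ t ∈ Icc 0 (T - s), ∫⁻ x, ‖u' (t + s) x‖ₑ ^ 2 ≤ C := by
    obtain ⟨C, hC, h⟩ := hE'
    exact ⟨C, hC, fun t ht => h _ (hmem t ht)⟩
  have hbdT : ∀ t ∈ Icc 0 (T - s), ∀ y, ‖u (t + s) y‖ ≤ M := fun t ht => hbd _ (hmem t ht)
  have hbdT' : ∀ t ∈ Icc 0 (T - s), ∀ y, ‖u' (t + s) y‖ ≤ M' := fun t ht => hbd' _ (hmem t ht)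
  have hEsT : eLpNorm (fun y => u' (0 + s) y - u (0 + s) y) 2 volume ≤ ENNReal.ofReal Es := by
    simpa only [zero_add] using hEs
  -- the unforced/`L²`-forced plumbing (as in `sup_stability_forced_smoothing_free`)
  have hgc : Continuous (uncurry (0 : ℝ → EuclideanSpace ℝ (Fin 3) → EuclideanSpace ℝ (Fin 3))) :=
    continuous_const
  have hG : ∀ τ ∈ Icc 0 (T - s), ∀ y,
      ‖(0 : ℝ → EuclideanSpace ℝ (Fin 3) → EuclideanSpace ℝ (Fin 3)) τ y‖ ≤ 0 := fun τ _ y => by simp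
  have hgdiv : ∀ τ ∈ Icc 0 (T - s),
      IsWeaklyDivFree ((0 : ℝ → EuclideanSpace ℝ (Fin 3) → EuclideanSpace ℝ (Fin 3)) τ) :=
    fun τ _ θ _ => by simp
  have hg2 : ∀ τ ∈ Icc 0 (T - s),
      eLpNorm ((0 : ℝ → EuclideanSpace ℝ (Fin 3) → EuclideanSpace ℝ (Fin 3)) τ) 2 volume ≤ (0 : ℝ≥0∞) :=
    fun τ _ => by simp
  have hg'slcT : ∀ τ, Continuous (g' (τ + s)) := fun τ =>
    hg'c.comp (continuous_const.prodMk continuous_id)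
  have hg'memT : ∀ τ ∈ Icc 0 (T - s), MemLp (g' (τ + s)) 2 volume := fun τ hτ =>
    ⟨(hg'slcT τ).aestronglyMeasurable, (hg'2T τ hτ).trans_lt ENNReal.ofReal_lt_top⟩
  have h := sup_stability_forced_smoothing_core_explicit hν hTs' hclT hclT' hgc hg'cT hG hG'T hgdiv
    hg'divT ENNReal.zero_ne_top ENNReal.ofReal_ne_top hg2 hg'2T hET hET' hM hM' hbdT hbdT' hTs hEs0 hEsT
    (F := 4 * ν ^ (-(3 / 4 : ℝ)) * (T - s) ^ (1 / 4 : ℝ) * G₂r) (by positivity) ?_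
  · intro t ht x
    have htI : t - s ∈ Ioc 0 (T - s) := ⟨sub_pos.2 ht.1, by linarith [ht.2]⟩
    have h' := h (t - s) htI x
    simpa only [sub_add_cancel] using h'
  · intro t ht x
    have h0 : forceDuhamel ν 0 (0 : ℝ → EuclideanSpace ℝ (Fin 3) → EuclideanSpace ℝ (Fin 3)) t x = 0 := by
      rw [forceDuhamel_apply]
      have hz : ∀ τ, UnboundedOperators.heatExtension
          ((0 : ℝ → EuclideanSpace ℝ (Fin 3) → EuclideanSpace ℝ (Fin 3)) τ) (ν * (t - τ)) x = 0 := by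
        intro τ
        have : ((0 : ℝ → EuclideanSpace ℝ (Fin 3) → EuclideanSpace ℝ (Fin 3)) τ) =
            fun _ : EuclideanSpace ℝ (Fin 3) => (0 : EuclideanSpace ℝ (Fin 3)) := rfl
        rw [this, UnboundedOperators.heatExtension_zero_fun]; rfl
      simp_rw [hz, integral_zero]
    rw [h0, sub_zero]
    refine (norm_forceDuhamel_le_of_eLpNorm_two hν ht.1 hG₂r
      (fun τ hτ => hg'memT τ ⟨hτ.1.le, hτ.2.le.trans ht.2⟩)
      (fun τ hτ => hg'2T τ ⟨hτ.1.le, hτ.2.le.trans ht.2⟩) x).trans ?_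
    have ht4 : t ^ (1 / 4 : ℝ) ≤ (T - s) ^ (1 / 4 : ℝ) := Real.rpow_le_rpow ht.1.le ht.2 (by norm_num)
    have hν34 : 0 ≤ 4 * ν ^ (-(3 / 4 : ℝ)) := by positivity
    gcongr

end Explicit

end Literature.Analysis.FluidPDE

end
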